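import Literature.AnabelianGeometry.EtaleTheta.Discharge.Sec2AutKDottedOfOdd
import Literature.AnabelianGeometry.EtaleTheta.Discharge.Sec2HasMuLModelChiCusp
import HarnessLib

/-!
# [EtTh] Rmk. 2.6.1 (dotted) for the R312 cover constructor `temperedCoverDataOfHuuOfSection` and at the Kummer-carrying
# cusped inversion model `χ′` — NO Prop. 2.6, NO slimness (proof-only; the `χ′` half of row (w2))

S. Mochizuki, *The étale theta function and its Frobenioid-theoretic manifestations*, Publ. RIMS **45** (2009) [EtTh], §2,
Rmk. 2.6.1 p. 40 («the 'Aut_K(−)'s' of the various once-dotted versions … direct product … with `Gal(Ċ^log/C^log) ≅ {±1}`»)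
[cite: MochizukiEtTh2009, Rmk 2.6.1 p.40]. Cell abc-iut, layer L2, seat abc-iut-L2-t12 (gen 9), row (w2) «COR29-SIX-COUNT@κ′/χ′
WITHOUT PROP26» (R848/R898), file 3 (the `χ′` half that the tree's data allow). PROOF-ONLY (no definition, no instance, no `Prop` fact).
Inputs BY NAME: file 1 `Sec2AutKDottedOfOdd` (`rmk261_dotted_of_odd`), abc-iut-L2-d3 / abc-iut-L2-t10's R312 constructor
`CLevelData.temperedCoverDataOfHuuOfSection` with `temperedCoverDataOfHuuOfSection_hTheta` / `_rmk261` / `hasMuL_coverOfRecordχ'`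
(`Sec2HasMuLModelChiCusp`, p466422), the `χ′` plumbing (`cLevelDataInvχ'`, `sectionχ'`, `Huuχ`, `iotaStable_conjX_epsPMInvχ'`,
`nonempty_orbitEmbeddingOfHuuOfSection`). Nothing restated.

* §1 (any `MuTwoSetting`): `temperedCoverDataOfHuuOfSection_rmk261_dotted_of_odd` — abc-iut-L2-t2's `T.Rmk261_dotted` for the
  R312 constructor with NO binder beyond the constructor's own (abc-iut-L2-t10's `temperedCoverDataOfHuuOfSection_rmk261_dotted_of_slimX`
  needed `T.Prop26` (F-0610), slimness of `Π^tp_X` and `l ≠ 1`).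
* §2 (`χ′`): `exists_orbitEmbedding_hasMuL_rmk261_dotted_inversionModelχ'` — abc-iut-L2-t10's χ′ census
  `exists_orbitEmbedding_hasMuL_rmk261_inversionModelχ'` with clause (iv) «`T.Prop26 → T.Rmk261_dotted`» now UNCONDITIONAL
  (`T.Rmk261_dotted`) and the hypothesis `l ≠ 1` dropped: for odd `l ∣ p − 1`, THE R312 cover of record on `Π^tp_C(inversionModelχ′)`
  has an `OrbitEmbedding`, `HasMuL`, Rmk. 2.6.1 undotted AND dotted.
HONEST LIMITS: the Cor. 2.9 COUNT at `χ′` is NOT delivered here — it needs the cusp-stabiliser discharges `hC1` / `hC2`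
(`cuspStabC` of the R312 constructor), which the tree holds only for abc-iut-L2-d3's cusp-law constructor `temperedCoverData` (used at
`κ′` in file 2, `Sec2Cor29ModelKrullOfOdd`); the generic `cor29_card_of_odd` applies verbatim once those are supplied. SEMI-SYNTHETIC
model — consistency / non-vacuity evidence for the typed §2 interface only; nothing of [EtTh] asserted for genuine tempered fundamental
groups; no side taken on [IUTchIII] Cor. 3.12; typed ≠ proved; instantiated ≠ endorsed.
-/

noncomputable section

namespace Literature.AnabelianGeometry.EtaleTheta

open Literature.AnabelianGeometry.SemiGraphs ThetaCovers
open _root_.Topology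

/-! ## §1. The R312 constructor: Rmk. 2.6.1 (dotted) with no Prop. 2.6 and no slimness -/

namespace MuTwoSetting.CLevelData

variable {p : ℕ} [Fact p.Prime] {M : MuTwoSetting p}
variable {PC : Type} [Group PC] [TopologicalSpace PC] [IsTopologicalGroup PC] [T2Space PC]

/-- **[EtTh] Rmk. 2.6.1 (dotted) for the R312 constructor of record, NO extra binder**: `Aut_K(Ż) ≅ Aut_K(Z) × Gal(Ċ/C)` for
`Z ∈ {X̲̲, X̲, C̲̲, C̲}` (given `μ_l ⊆ K`, inside the typed statement) — `rmk261_dotted_of_odd` fed with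
`temperedCoverDataOfHuuOfSection_hTheta`; abc-iut-L2-t10's `…_rmk261_dotted_of_slimX` needed Prop. 2.6, slimness and `l ≠ 1`.
[cite: MochizukiEtTh2009, Rmk 2.6.1 p.40] -/
theorem temperedCoverDataOfHuuOfSection_rmk261_dotted_of_odd (e : M.CLevelData) (ιC : M.GtpC →ₜ* PC)
    (hιC : IsProfiniteCompletion ιC) (hinj : Function.Injective ιC) (op : M.toThetaSetting.OncePuncturedData)
    {l : ℕ} [NeZero l] (hodd : Odd l)
    (s : ↥M.GK →* M.PiTemp) (hsa : ∀ σ, M.aug (s σ) = (σ : GQp p)) (hsZ : ∀ σ, M.toZ (s σ) = 1)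
    (hιell : ∀ c ∈ (e.piCDataOf ιC hιC).augGK.ker, c ∉ (e.piCDataOf ιC hιC).PiX →
      ∀ d ∈ (e.piCDataOf ιC hιC).PiX ⊓ (e.piCDataOf ιC hιC).augGK.ker,
        c * d * c⁻¹ * d ∈ (e.piCDataOf ιC hιC).barTheta l)
    (hN : ((M.GtpXu l).map M.inclX).Normal) (hY : (M.GtpY.map M.inclX).Normal)
    {E : M.toThetaSetting.EtaleThetaData} (C : E.DoubleUnderline l) (hK : M.barKerTp l ≤ C.Huu)
    (hsH : ∀ σ, s σ ∈ C.Huu) {g : M.GtpC} (hgX : g ∉ M.inclX.range) (hι : C.IotaStable (e.conjX g)) :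
    (e.temperedCoverDataOfHuuOfSection ιC hιC hinj op hodd s hsa hsZ hιell hN hY C hK hsH hgX hι).Rmk261_dotted :=
  (e.temperedCoverDataOfHuuOfSection ιC hιC hinj op hodd s hsa hsZ hιell hN hY C hK hsH hgX hι).rmk261_dotted_of_odd
    (e.temperedCoverDataOfHuuOfSection_hTheta ιC hιC hinj op hodd s hsa hsZ hιell hN hY C hK hsH hgX hι)

end MuTwoSetting.CLevelData

/-! ## §2. At the Kummer-carrying cusped inversion model `χ′` -/

namespace SettingModel

open ThetaSetting

variable (p : ℕ) [Fact p.Prime]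

/-- **THE χ′ CENSUS for the R312 cover of record, Rmk. 2.6.1 dotted now UNCONDITIONAL.** For every odd `l ∣ p − 1`, every
étale-theta datum `E` over `modelχ′`, every `X̲̲` with `Π^tp_{X̲̲} = Huuχ p l` and Def. 1.9 points `τ, τ′`: a `TemperedCoverData` `T` on
THE `Π^tp_C` of `inversionModelχ′` with (i) an `OrbitEmbedding C T` (R312), (ii) `HasMuL`, (iii) Rmk. 2.6.1 undotted — `Aut_K(X̲̲) ≅
ℤ/l × ℤ/2`, `Aut_K(X̲) ≅ D_l`, `Aut_K(C̲̲) ≅ ℤ/l`, `Aut_K(C̲) = 1` — and (iv) **Rmk. 2.6.1 dotted, `T.Rmk261_dotted`, with NO Prop. 2.6**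
(abc-iut-L2-t10's census had «`T.Prop26 → T.Rmk261_dotted`» and `l ≠ 1`). [cite: MochizukiEtTh2009, Rmk 2.6.1 p.40] -/
theorem exists_orbitEmbedding_hasMuL_rmk261_dotted_inversionModelχ' {E : (ThetaSetting.modelχ' p).EtaleThetaData} {l : ℕ+}
    (hodd : Odd (l : ℕ)) (hl : (l : ℕ) ∣ p - 1) (C : E.DoubleUnderline (l : ℕ)) (hC : C.Huu = Huuχ p l)
    (τ τ' : ThetaSetting.NonCuspidalPoint E.toKummerData) :
    ∃ T : TemperedCoverData.{0} l, T.Gtp = (MuTwoSetting.inversionModelχ' p).GtpC ∧ Nonempty (C.OrbitEmbedding T) ∧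
      T.HasMuL ∧
      (Nonempty (T.autK (T.tp T.PiXuu) ≃* Multiplicative (ZMod l) × Multiplicative (ZMod 2)) ∧
        Nonempty (T.autK (T.tp T.PiXu) ≃* DihedralGroup l) ∧
        Nonempty (T.autK (T.tp T.PiCuu) ≃* Multiplicative (ZMod l)) ∧
        Subsingleton (T.autK (T.tp T.PiCu))) ∧
      T.Rmk261_dotted := by
  obtain ⟨eX⟩ := nonempty_oncePuncturedData_modelχ' p
  have hK : (MuTwoSetting.inversionModelχ' p).barKerTp l ≤ C.Huu := hC ▸ barKerTp_le_Huuχ_inversionModelχ' p l hodd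
  have hsH : ∀ σ, sectionχ' p σ ∈ C.Huu := fun σ => by rw [hC]; exact inr_mem_Huuχ p l σ
  have hMuL := hasMuL_coverOfRecordχ' p hodd hl C eX hK hsH (iotaStable_conjX_epsPMInvχ' p C hC)
  refine ⟨_, rfl, (cLevelDataInvχ' p).nonempty_orbitEmbeddingOfHuuOfSection _ _ _ eX hodd _ _ _ _ _ _ C hK hsH _ _ τ τ',
    hMuL, ?_, ?_⟩
  · exact (cLevelDataInvχ' p).temperedCoverDataOfHuuOfSection_rmk261 _ _ _ eX hodd _ _ _ _ _ _ C hK hsH _ _ hMuL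
  · exact (cLevelDataInvχ' p).temperedCoverDataOfHuuOfSection_rmk261_dotted_of_odd _ _ _ eX hodd _ _ _ _ _ _ C hK
      hsH _ _

/-- **The dotted `Aut_K` groups at `χ′`, spelled out** (for odd `l ∣ p − 1`, THE R312 cover of record): `Aut_K(Ẋ̲̲) ≅ (ℤ/l × ℤ/2) × ℤ/2`,
`Aut_K(Ẋ̲) ≅ D_l × ℤ/2`, `Aut_K(Ċ̲̲) ≅ ℤ/l × ℤ/2`, `Aut_K(Ċ̲) ≅ ℤ/2` — unconditionally (`HasMuL` discharged by `l ∣ p − 1`).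
[cite: MochizukiEtTh2009, Rmk 2.6.1 p.40] -/
theorem exists_autK_dotted_inversionModelχ' {E : (ThetaSetting.modelχ' p).EtaleThetaData} {l : ℕ+}
    (hodd : Odd (l : ℕ)) (hl : (l : ℕ) ∣ p - 1) (C : E.DoubleUnderline (l : ℕ)) (hC : C.Huu = Huuχ p l)
    (τ τ' : ThetaSetting.NonCuspidalPoint E.toKummerData) :
    ∃ T : TemperedCoverData.{0} l, T.Gtp = (MuTwoSetting.inversionModelχ' p).GtpC ∧ Nonempty (C.OrbitEmbedding T) ∧
      Nonempty (T.autK (T.tp T.PiXuu ⊓ T.PiCdot) ≃*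
          (Multiplicative (ZMod l) × Multiplicative (ZMod 2)) × Multiplicative (ZMod 2)) ∧
      Nonempty (T.autK (T.tp T.PiXu ⊓ T.PiCdot) ≃* DihedralGroup l × Multiplicative (ZMod 2)) ∧
      Nonempty (T.autK (T.tp T.PiCuu ⊓ T.PiCdot) ≃* Multiplicative (ZMod l) × Multiplicative (ZMod 2)) ∧
      Nonempty (T.autK (T.tp T.PiCu ⊓ T.PiCdot) ≃* Multiplicative (ZMod 2)) := by
  obtain ⟨T, hT, hemb, hMuL, -, hdot⟩ := exists_orbitEmbedding_hasMuL_rmk261_dotted_inversionModelχ' p hodd hl C hC τ τ'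
  obtain ⟨h1, h2, h3, h4⟩ := hdot hMuL
  exact ⟨T, hT, hemb, h1, h2, h3, h4⟩

end SettingModel

end Literature.AnabelianGeometry.EtaleTheta

end
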